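import Mathlib

/-!
# RootDecomp1EGenericityFloor — lens 2, generation 38: THE GENERICITY FLOOR of route RootDecomp1E (RULE E-R19's yardstick) — part 1 (RootDecomp1EGenericityFloor01): §1 maximal algebraically independent coordinate sets, `trdeg ≤ #S`, `coordFamily`; §2 countable zeros of entire functions, `expPoly`

PORT NOTE (census-1 gen 16, 2026-08-31): port of [HOME/decomp-schanuel-lens-2/g38/port/RootDecomp1EGenericityFloor01.lean 5821235e… (256 l) + …02.lean ca3de805… (305 l), copy-ready per NOTE L1838; source GenericScale.lean §7 (ed.1 b58a0d29… / ed.2 cf4f06e4…); critic VERDICT L1833 (C): INSTRUMENT «GENERICITY FLOOR» ACCEPTED on service lane (α) as the 1E YARDSTICK of RULE E-R19; PORT GO own chain].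
Three parts (lens-2 cut two; the second is split again for the 398-line cap once the private copies are added) (01 = maximal a.i. coordinate sets, `trdeg ≤ #S`, `coordFamily`, countable zeros of entire functions, `expPoly`; 02 = `exists_expPoly_ne_zero`
(the functions `t`, `e^{ct}` are algebraically independent over ℚ(θ)); 03 = THE GENERICITY FLOOR `countable_bad_scales_complex / _range / countable_bad_scales / floor_of_embedding` and
the yardsticks `countable_not_schanuel_of_defectOne / _of_schanuel`). PORT EDITS: `set_option linter.dupNamespace false` dropped; five folklore lemmas with tree twins made private
(`exists_finset_algebraicIndependent_maximal`, `trdeg_adjoin_le_card` — Literature TrdegZariskiDim; `natCast_le_trdeg_of_algebraicIndependent` — 1B DefectFloorCellsKit; `countable_mvPolynomial_rat`,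
`polynomial_eval_aeval`), with private copies in parts 02/03; statements and proofs otherwise verbatim; `import Mathlib` only (no Theses, no route vocabulary). `--supports stmt-Schanuel-31409`;
no census credit; nothing here proves Schanuel; rung 0. Lens-2's header follows.
-/

/-!
# RootDecomp1EGenericityFloor (part 1 of 2) — the GENERICITY FLOOR of route `RootDecomp1E` (critic's RULE
E-R19, STATUS L1800 / VERDICT L1833; lens-2 g38 instrument, service lane (α); HOME source
`decomp-schanuel-lens-2/g38/GenericScale.lean` §7, sha256 b58a0d29…): for EVERY `w : Fin m → ℂ` and `i₀`
with `w_{i₀} ≠ 0`, all but COUNTABLY many complex `u` give `trdeg ℚ(z, e^z) ≥ trdeg ℚ(w, e^w) + 2` for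
every tuple `z ⊇ (w, u·w_{i₀})`. Part 1: a maximal algebraically independent coordinate set and
`trdeg ≤ #S`, the coordinate family `(w, e^w)`, countability of the zeros of a non-trivial entire
function, the exponential polynomials `t ↦ P(e^{ct}, t, θ)` and two evaluation-in-stages identities.
Part 2: the algebraic independence of the FUNCTIONS `t`, `e^{ct}` over `ℚ(θ)` and the floor theorems.
Mathlib only; sorry-free; standard axioms. [folklore throughout]
-/

noncomputable section

open Complex MvPolynomial
open scoped IntermediateField.algebraAdjoinAdjoin

namespace Summit.Schanuel.Schanuel.Theorems.RootDecomp1EGenericityFloor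

/-! ## §1 Maximal algebraically independent coordinate sets, `trdeg ≤ #S` -/

/-- an (unanchored) maximal algebraically independent sub-family of the coordinates of a point -/
private theorem exists_finset_algebraicIndependent_maximal {ι : Type} [Fintype ι] (P : ι → ℂ) :
    ∃ S : Finset ι, AlgebraicIndependent ℚ (fun i : S => P i) ∧
      ∀ j, IsAlgebraic (Algebra.adjoin ℚ (Set.range fun i : S => P i)) (P j) := by
  classical
  let good : Finset ι → Prop := fun S => AlgebraicIndependent ℚ (fun i : S => P i)
  have hgood0 : good ∅ := by
    haveI : IsEmpty {i // i ∈ (∅ : Finset ι)} := ⟨fun i => Finset.notMem_empty _ i.2⟩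
    exact algebraicIndependent_empty_type
  have hne : ((Finset.univ : Finset (Finset ι)).filter good).Nonempty := ⟨∅, by simpa using hgood0⟩
  obtain ⟨S, hS, hmax⟩ := Finset.exists_max_image _ Finset.card hne
  simp only [Finset.mem_filter, Finset.mem_univ, true_and] at hS hmax
  refine ⟨S, hS, fun j => ?_⟩
  by_contra htr
  have hopt : AlgebraicIndependent ℚ (fun o : Option S => o.elim (P j) (fun i : S => P i)) :=
    (hS.option_iff_transcendental (P j)).mpr htr
  have hjS : j ∉ S := by
    intro hj
    exact htr (isAlgebraic_algebraMap
      (⟨P j, Algebra.subset_adjoin ⟨⟨j, hj⟩, rfl⟩⟩ : Algebra.adjoin ℚ (Set.range fun i : S => P i)))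
  let f : {i // i ∈ insert j S} → Option S := fun i =>
    if h : (i : ι) ∈ S then some ⟨i, h⟩ else none
  have hf_of_not : ∀ i : {i // i ∈ insert j S}, (i : ι) ∉ S → (i : ι) = j := fun i hi => by
    have := i.2
    rw [Finset.mem_insert] at this
    tauto
  have hf : Function.Injective f := by
    intro a b hab
    by_cases ha : (a : ι) ∈ S <;> by_cases hb : (b : ι) ∈ S
    · simp only [f, ha, hb, dif_pos, Option.some.injEq, Subtype.mk.injEq] at hab
      exact Subtype.ext hab
    · simp [f, ha, hb] at hab
    · simp [f, ha, hb] at hab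
    · exact Subtype.ext ((hf_of_not a ha).trans (hf_of_not b hb).symm)
  have hgood : good (insert j S) := by
    have hcomp := hopt.comp f hf
    have hfun : ((fun o : Option S => o.elim (P j) (fun i : S => P i)) ∘ f) =
        fun i : {i // i ∈ insert j S} => P i := by
      funext i
      by_cases h : (i : ι) ∈ S
      · simp [f, h]
      · simp [f, hf_of_not i h, hjS]
    show AlgebraicIndependent ℚ (fun i : {i // i ∈ insert j S} => P i)
    simpa only [hfun] using hcomp
  have := hmax _ hgood
  rw [Finset.card_insert_of_notMem hjS] at this
  omega

/-- With `S` as above, `trdeg_ℚ ℚ(P) ≤ #S`. (Verbatim copy of `Literature.NumberTheory.Transcendental.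
TrdegZariskiDim.trdeg_adjoin_le_card` — copied, not imported, only because that module was not built on
the farm at the time of writing.) [folklore] -/
private theorem trdeg_adjoin_le_card {ι : Type} (P : ι → ℂ) (S : Finset ι)
    (halg : ∀ j, IsAlgebraic (Algebra.adjoin ℚ (Set.range fun i : S => P i)) (P j)) :
    Algebra.trdeg ℚ (IntermediateField.adjoin ℚ (Set.range P)) ≤ S.card := by
  classical
  set x : S → ℂ := fun i => P i with hx
  set T : Set ℂ := Set.range x with hT
  let R₀ : Subalgebra ℚ ℂ := Algebra.adjoin ℚ T
  let E₀ : IntermediateField ℚ ℂ := IntermediateField.adjoin ℚ T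
  let E : IntermediateField ℚ ℂ := IntermediateField.adjoin ℚ (Set.range P)
  have halgE₀ : ∀ j, IsAlgebraic E₀ (P j) := fun j =>
    IntermediateField.isAlgebraic_adjoin_iff.mpr (halg j)
  have hEle : E ≤ (algebraicClosure E₀ ℂ).restrictScalars ℚ := by
    refine IntermediateField.adjoin_le_iff.mpr ?_
    rintro _ ⟨j, rfl⟩
    exact mem_algebraicClosure_iff.mpr (halgE₀ j)
  have halgR₀ : ∀ e : E, IsAlgebraic R₀ (e : ℂ) := fun e =>
    (IsFractionRing.isAlgebraic_iff R₀ E₀ ℂ).mpr (mem_algebraicClosure_iff.mp (hEle e.2))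
  have hmemE : ∀ i, P i ∈ E := fun i => IntermediateField.subset_adjoin _ _ ⟨i, rfl⟩
  let y : S → E := fun a => ⟨P a, hmemE a⟩
  let sE : Set E := Set.range y
  let v : E →ₐ[ℚ] ℂ := (algebraMap E ℂ).toRatAlgHom
  have hvinj : Function.Injective v := (algebraMap E ℂ).injective
  have himage : (v : E → ℂ) '' sE = T := by
    apply Set.Subset.antisymm
    · rintro _ ⟨_, ⟨a, rfl⟩, rfl⟩
      exact ⟨a, rfl⟩
    · rintro _ ⟨a, rfl⟩
      exact ⟨y a, ⟨a, rfl⟩, rfl⟩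
  have hmap : (Algebra.adjoin ℚ sE).map v = R₀ := by
    rw [AlgHom.map_adjoin, himage]
  let e₁ : Algebra.adjoin ℚ sE ≃ₐ[ℚ] R₀ :=
    (Subalgebra.equivMapOfInjective _ v hvinj).trans (Subalgebra.equivOfEq _ _ hmap)
  have he₁ : ∀ r : Algebra.adjoin ℚ sE, ((e₁ r : R₀) : ℂ) = ((r : E) : ℂ) := fun r => by
    have h := Subalgebra.coe_equivMapOfInjective_apply (Algebra.adjoin ℚ sE) v hvinj r
    simp only [e₁, AlgEquiv.trans_apply, Subalgebra.equivOfEq_apply]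
    rw [h]
    rfl
  haveI : Algebra.IsAlgebraic (Algebra.adjoin ℚ sE) E := by
    refine ⟨fun e => ?_⟩
    refine IsAlgebraic.of_ringHom_of_comp_eq (f := e₁.toAlgHom.toRingHom) (g := algebraMap E ℂ)
      (halgR₀ e) e₁.surjective (algebraMap E ℂ).injective ?_
    ext r
    exact he₁ r
  calc Algebra.trdeg ℚ E ≤ Cardinal.mk sE := Algebra.IsAlgebraic.trdeg_le_cardinalMk ℚ sE
    _ ≤ Cardinal.mk S := Cardinal.mk_range_le
    _ = S.card := Cardinal.mk_coe_finset

/-- `k` algebraically independent elements of `L` give `k ≤ trdeg_ℚ L`. [folklore]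
(Twin of `RootDecomp1BDefectFloorCells.natCast_le_trdeg_of_algebraicIndependent`, restated to keep this
instrument free of route-1B imports.) -/
private theorem natCast_le_trdeg_of_algebraicIndependent {k : ℕ} {L : IntermediateField ℚ ℂ}
    {z : Fin k → ℂ} (hz : AlgebraicIndependent ℚ z) (hmem : ∀ i, z i ∈ L) :
    (k : Cardinal) ≤ Algebra.trdeg ℚ ↥L := by
  let z' : Fin k → ↥L := fun i => ⟨z i, hmem i⟩
  have hz' : AlgebraicIndependent ℚ z' := AlgebraicIndependent.of_comp L.val hz
  simpa using hz'.cardinalMk_le_trdeg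

variable {m : ℕ}

/-- the coordinate tuple `(w, e^w)` of an `m`-tuple, indexed by `Fin (m + m)` -/
def coordFamily (w : Fin m → ℂ) : Fin (m + m) → ℂ := Sum.elim w (cexp ∘ w) ∘ finSumFinEquiv.symm

/-- the first `m` coordinates of `coordFamily w` are `w` -/
theorem coordFamily_castAdd (w : Fin m → ℂ) (i : Fin m) : coordFamily w (Fin.castAdd m i) = w i := by
  simp only [coordFamily, Function.comp_apply, finSumFinEquiv_symm_apply_castAdd, Sum.elim_inl]

/-- the last `m` coordinates of `coordFamily w` are `e^w` -/
theorem coordFamily_natAdd (w : Fin m → ℂ) (i : Fin m) :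
    coordFamily w (Fin.natAdd m i) = cexp (w i) := by
  simp only [coordFamily, Function.comp_apply, finSumFinEquiv_symm_apply_natAdd, Sum.elim_inr]

/-- `range (coordFamily w) = range w ∪ range (e^w)` -/
theorem range_coordFamily (w : Fin m → ℂ) :
    Set.range (coordFamily w) = Set.range w ∪ Set.range (cexp ∘ w) := by
  rw [coordFamily, finSumFinEquiv.symm.surjective.range_comp, Set.Sum.elim_range]

/-! ## §2 Zeros of entire functions; exponential polynomials -/

open Filter Topology

/-- **zeros of a non-trivial entire function are countable** [folklore] -/
theorem countable_zeros_of_analyticOnNhd {f : ℂ → ℂ} (hf : AnalyticOnNhd ℂ f Set.univ) {t₀ : ℂ}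
    (ht₀ : f t₀ ≠ 0) : {z : ℂ | f z = 0}.Countable := by
  have hfin : ∀ n : ℕ, ({z : ℂ | f z = 0} ∩ Metric.closedBall 0 n).Finite := by
    intro n
    by_contra hinf
    obtain ⟨x, -, hx⟩ := (Set.not_finite.mp hinf).exists_accPt_of_subset_isCompact
      (isCompact_closedBall (0 : ℂ) n) Set.inter_subset_right
    have hfreq : ∃ᶠ z in 𝓝[≠] x, f z = 0 :=
      (accPt_iff_frequently_nhdsNE.mp hx).mono fun z hz => hz.1
    have h0 := hf.eqOn_zero_of_preconnected_of_frequently_eq_zero isPreconnected_univ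
      (Set.mem_univ x) hfreq
    exact ht₀ (h0 (Set.mem_univ t₀))
  have heq : {z : ℂ | f z = 0} = ⋃ n : ℕ, ({z : ℂ | f z = 0} ∩ Metric.closedBall 0 n) := by
    ext z
    simp only [Set.mem_iUnion, Set.mem_inter_iff, Metric.mem_closedBall, dist_zero_right,
      Set.mem_setOf_eq]
    constructor
    · intro hz
      obtain ⟨n, hn⟩ := exists_nat_ge ‖z‖
      exact ⟨n, hz, hn⟩
    · rintro ⟨n, hz, -⟩
      exact hz
  rw [heq]
  exact Set.countable_iUnion fun n => (hfin n).countable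

/-- … hence its REAL zeros are countable -/
theorem countable_real_zeros_of_analyticOnNhd {f : ℂ → ℂ} (hf : AnalyticOnNhd ℂ f Set.univ) {t₀ : ℂ}
    (ht₀ : f t₀ ≠ 0) : {ρ : ℝ | f (ρ : ℂ) = 0}.Countable :=
  (countable_zeros_of_analyticOnNhd hf ht₀).preimage Complex.ofReal_injective

variable {k : ℕ}

/-- the exponential polynomial `t ↦ P(e^{ct}, t, θ)` attached to an integer polynomial `P` -/
def expPoly (θ : Fin k → ℂ) (c : ℂ) (P : MvPolynomial (Fin (k + 2)) ℚ) (t : ℂ) : ℂ :=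
  aeval (Fin.cons (cexp (c * t)) (Fin.cons t θ) : Fin (k + 2) → ℂ) P

/-- exponential polynomials are entire -/
theorem differentiable_expPoly (θ : Fin k → ℂ) (c : ℂ) (P : MvPolynomial (Fin (k + 2)) ℚ) :
    Differentiable ℂ (expPoly θ c P) := by
  unfold expPoly
  induction P using MvPolynomial.induction_on with
  | C a =>
    have : (fun t : ℂ => aeval (Fin.cons (cexp (c * t)) (Fin.cons t θ) : Fin (k + 2) → ℂ)
        (MvPolynomial.C a)) = fun _ => (a : ℂ) := by
      funext t; simp
    rw [this]
    exact differentiable_const (a : ℂ)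
  | add p q hp hq =>
    have : (fun t : ℂ => aeval (Fin.cons (cexp (c * t)) (Fin.cons t θ) : Fin (k + 2) → ℂ) (p + q)) =
        fun t => aeval (Fin.cons (cexp (c * t)) (Fin.cons t θ) : Fin (k + 2) → ℂ) p +
          aeval (Fin.cons (cexp (c * t)) (Fin.cons t θ) : Fin (k + 2) → ℂ) q := by
      funext t; simp only [map_add]
    rw [this]
    exact hp.add hq
  | mul_X p i hp =>
    have : (fun t : ℂ => aeval (Fin.cons (cexp (c * t)) (Fin.cons t θ) : Fin (k + 2) → ℂ)
        (p * MvPolynomial.X i)) =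
        fun t => aeval (Fin.cons (cexp (c * t)) (Fin.cons t θ) : Fin (k + 2) → ℂ) p *
          (Fin.cons (cexp (c * t)) (Fin.cons t θ) : Fin (k + 2) → ℂ) i := by
      funext t; simp only [map_mul, MvPolynomial.aeval_X]
    rw [this]
    refine hp.mul ?_
    refine Fin.cases ?_ (fun i' => Fin.cases ?_ (fun j => ?_) i') i
    · simp only [Fin.cons_zero]
      exact (differentiable_id.const_mul c).cexp
    · simp only [Fin.cons_succ, Fin.cons_zero]
      exact differentiable_id
    · simp only [Fin.cons_succ]
      exact differentiable_const (θ j)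

/-- exponential polynomials are analytic on `ℂ` -/
theorem analyticOnNhd_expPoly (θ : Fin k → ℂ) (c : ℂ) (P : MvPolynomial (Fin (k + 2)) ℚ) :
    AnalyticOnNhd ℂ (expPoly θ c P) Set.univ :=
  analyticOnNhd_univ_iff_differentiable.mpr (differentiable_expPoly θ c P)

/-- evaluation in stages: a polynomial-valued substitution followed by evaluation -/
private theorem polynomial_eval_aeval (g : Fin (k + 2) → Polynomial ℂ) (s : ℂ)
    (P : MvPolynomial (Fin (k + 2)) ℚ) :
    Polynomial.eval s (aeval g P) = aeval (fun i => Polynomial.eval s (g i)) P := by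
  induction P using MvPolynomial.induction_on with
  | C a => simp
  | add p q hp hq => simp only [map_add, Polynomial.eval_add, hp, hq]
  | mul_X p i hp => simp only [map_mul, MvPolynomial.aeval_X, Polynomial.eval_mul, hp]

/-- evaluation in stages over `ℚ`: substitute rational constants for the first two variables -/
theorem aeval_aeval_cons_cons (φ : MvPolynomial (Fin k) ℚ →ₐ[ℚ] ℂ) (u t : ℚ)
    (P : MvPolynomial (Fin (k + 2)) ℚ) :
    φ (aeval (Fin.cons (C u) (Fin.cons (C t) X) : Fin (k + 2) → MvPolynomial (Fin k) ℚ) P) =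
      aeval (Fin.cons (u : ℂ) (Fin.cons (t : ℂ) (fun j => φ (X j))) : Fin (k + 2) → ℂ) P := by
  induction P using MvPolynomial.induction_on with
  | C a => simp
  | add p q hp hq => simp only [map_add, hp, hq]
  | mul_X p i hp =>
    simp only [map_mul, MvPolynomial.aeval_X, hp]
    congr 1
    refine Fin.cases ?_ (fun i' => Fin.cases ?_ (fun j => ?_) i') i
    · simp
    · simp
    · simp only [Fin.cons_succ]

end Summit.Schanuel.Schanuel.Theorems.RootDecomp1EGenericityFloor

end
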